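import Mathlib
import Summits.ValiantsHypothesis.ValiantsHypothesis.Theorems.BarrierLeverPartitionMinorsHitByVPHiddenStatesSecondShellChainFourIdentity

/-!
# Route BarrierLever — item `PartitionMinorsHitByVP` (stmt-ValiantsHypothesis-19717), line `hidden-states`:
# THE FOUR-MOVER CHAIN — the column identity of a table (toolkit for `…SecondShellChainFour`)

Helper file (`--supports stmt-ValiantsHypothesis-19717`; cell valiant-natproofs, 𝒟-side door (c), registered line
`Cruxes/PartitionMinorsHitByVP/Lines/hidden_states.lean` v8; prover seat val-np-p6 gen 18).  Closes NO item; definition-free.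

From the pure identity `…ChainFourIdentity.chain₄_column_identity` to a TABLE `w` whose four movers `e → c → b → a` form a chain
(unit rows on the inert block `Z` and on the read exits `D`): for every column `J` with `|J| ≤ |Z| + 3`, writing
`Y u = Σ_{q ∈ J} w u q` and `Φ = ∏_{z ∈ Z} Y z`, the value `Y_a Y_b Y_c Y_e Φ` of the start row `Z ∪ {a,b,c,e}` equals the explicit
combination of the values `(∏_{u ∈ T} Y u) Φ` of the rows `Z ∪ T` (★ `chain₄_column`; sums over ordered tuples of distinct
read exits, kernels as in the identity).  Bookkeeping only: the inert block is contained in the column or everything vanishes,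
the movers read `Z` through the constants `a₀, b₀, c₀, e₀`, exits are indicators, and the budget is `|J ∖ Z| ≤ 3`.

HONEST LABEL: conjecture-column toolkit (second shell, every `t, h`); 19717 stays OPEN; nothing on crux 14610 or VP ≠ VNP.
-/

set_option linter.dupNamespace false

namespace Summit.ValiantsHypothesis.ValiantsHypothesis.Theorems.BarrierLever.HiddenStates

open Finset

noncomputable section

namespace SecondShell

variable {α : Type} [Fintype α] [DecidableEq α]

/-! ## The column identity of a four-mover chain table -/

omit [Fintype α] in
set_option maxHeartbeats 800000 in
/-- ★ the value of the start row of a four-mover chain on a budget-three column, as a combination of the values of the rows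
`Z ∪ T`, `|T| ≤ 3` (sums over ordered tuples of distinct read exits `D`). -/
theorem chain₄_column (w : α → α → ℂ)
    (Z : Finset α) {a b c e : α} (hab : a ≠ b) (hac : a ≠ c) (hae : a ≠ e) (hbc : b ≠ c) (hbe : b ≠ e) (hce : c ≠ e)
    (haZ : a ∉ Z) (hbZ : b ∉ Z) (hcZ : c ∉ Z) (heZ : e ∉ Z)
    (hZ : ∀ z ∈ Z, ∀ q, w z q = if q = z then 1 else 0)
    (haa : w a a = 1) (hab₀ : w a b = 0) (hac₀ : w a c = 0) (hae₀ : w a e = 0)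
    (hbb : w b b = 1) (hbc₀ : w b c = 0) (hbe₀ : w b e = 0)
    (hcc : w c c = 1) (hca₀ : w c a = 0) (hce₀ : w c e = 0)
    (hee : w e e = 1) (hea₀ : w e a = 0) (heb₀ : w e b = 0)
    (hD : ∀ d, d ∉ Z → d ∉ ({a, b, c, e} : Finset α) → (w a d ≠ 0 ∨ w b d ≠ 0 ∨ w c d ≠ 0 ∨ w e d ≠ 0) →
      ∀ q, w d q = if q = d then 1 else 0)
    (D : Finset α)
    (hDiff : ∀ d, d ∈ D ↔ (d ∉ ({a, b, c, e} : Finset α) ∧ d ∉ Z) ∧ (w a d ≠ 0 ∨ w b d ≠ 0 ∨ w c d ≠ 0 ∨ w e d ≠ 0))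
    (J : Finset α) (hJ : J.card ≤ Z.card + 3) (Y : α → ℂ) (hY : ∀ u, Y u = ∑ q ∈ J, w u q)
    (Φ : ℂ) (hΦ : Φ = ∏ z ∈ Z, Y z) :
    Y a * Y b * Y c * Y e * Φ =
      ((-((∑ z ∈ Z, w a z) * (∑ z ∈ Z, w b z) * (∑ z ∈ Z, w c z) * (∑ z ∈ Z, w e z))
            - w e c * (∑ z ∈ Z, w a z) * (∑ z ∈ Z, w b z) * (∑ z ∈ Z, w c z)
            - w c b * (∑ z ∈ Z, w a z) * (∑ z ∈ Z, w b z) * (∑ z ∈ Z, w e z)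
            - w c b * w e c * (∑ z ∈ Z, w a z) * (∑ z ∈ Z, w b z)
            - w b a * (∑ z ∈ Z, w a z) * (∑ z ∈ Z, w c z) * (∑ z ∈ Z, w e z)
            - w b a * w e c * (∑ z ∈ Z, w a z) * (∑ z ∈ Z, w c z)
            - w b a * w c b * (∑ z ∈ Z, w a z) * (∑ z ∈ Z, w e z) - w b a * w c b * w e c * (∑ z ∈ Z, w a z)) * (1 * Φ)
        + ((∑ z ∈ Z, w b z) * (∑ z ∈ Z, w c z) * (∑ z ∈ Z, w e z) + w e c * (∑ z ∈ Z, w b z) * (∑ z ∈ Z, w c z)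
            + w c b * (∑ z ∈ Z, w b z) * (∑ z ∈ Z, w e z) + w c b * w e c * (∑ z ∈ Z, w b z)
            + w b a * (∑ z ∈ Z, w c z) * (∑ z ∈ Z, w e z) + w b a * w e c * (∑ z ∈ Z, w c z)
            + w b a * w c b * (∑ z ∈ Z, w e z) + w b a * w c b * w e c) * (Y a * Φ)
        + ((∑ z ∈ Z, w a z) * (∑ z ∈ Z, w c z) * (∑ z ∈ Z, w e z) + w e c * (∑ z ∈ Z, w a z) * (∑ z ∈ Z, w c z)
            + w c b * (∑ z ∈ Z, w a z) * (∑ z ∈ Z, w e z) + w c b * w e c * (∑ z ∈ Z, w a z)) * (Y b * Φ)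
        + ((∑ z ∈ Z, w a z) * (∑ z ∈ Z, w b z) * (∑ z ∈ Z, w e z) + w e c * (∑ z ∈ Z, w a z) * (∑ z ∈ Z, w b z)
            + w b a * (∑ z ∈ Z, w a z) * (∑ z ∈ Z, w e z) + w b a * w e c * (∑ z ∈ Z, w a z)) * (Y c * Φ)
        + ((∑ z ∈ Z, w a z) * (∑ z ∈ Z, w b z) * (∑ z ∈ Z, w c z) + w c b * (∑ z ∈ Z, w a z) * (∑ z ∈ Z, w b z)
            + w b a * (∑ z ∈ Z, w a z) * (∑ z ∈ Z, w c z) + w b a * w c b * (∑ z ∈ Z, w a z)) * (Y e * Φ)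
        + (-((∑ z ∈ Z, w c z) * (∑ z ∈ Z, w e z)) - w e c * (∑ z ∈ Z, w c z) - w c b * (∑ z ∈ Z, w e z)
            - w c b * w e c) * (Y a * Y b * Φ)
        + (-((∑ z ∈ Z, w b z) * (∑ z ∈ Z, w e z)) - w e c * (∑ z ∈ Z, w b z) - w b a * (∑ z ∈ Z, w e z)
            - w b a * w e c) * (Y a * Y c * Φ)
        + (-((∑ z ∈ Z, w b z) * (∑ z ∈ Z, w c z)) - w c b * (∑ z ∈ Z, w b z) - w b a * (∑ z ∈ Z, w c z)
            - w b a * w c b) * (Y a * Y e * Φ)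
        + (-((∑ z ∈ Z, w a z) * (∑ z ∈ Z, w e z)) - w e c * (∑ z ∈ Z, w a z)) * (Y b * Y c * Φ)
        + (-((∑ z ∈ Z, w a z) * (∑ z ∈ Z, w c z)) - w c b * (∑ z ∈ Z, w a z)) * (Y b * Y e * Φ)
        + (-((∑ z ∈ Z, w a z) * (∑ z ∈ Z, w b z)) - w b a * (∑ z ∈ Z, w a z)) * (Y c * Y e * Φ)
        + ((∑ z ∈ Z, w e z) + w e c) * (Y a * Y b * Y c * Φ)
        + ((∑ z ∈ Z, w c z) + w c b) * (Y a * Y b * Y e * Φ)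
        + ((∑ z ∈ Z, w b z) + w b a) * (Y a * Y c * Y e * Φ)
        + ((∑ z ∈ Z, w a z)) * (Y b * Y c * Y e * Φ))
      + ∑ d ∈ D, ((3 * w a d * w b d * w c d * w e d + 2 * (∑ z ∈ Z, w e z) * w a d * w b d * w c d
            + 2 * (∑ z ∈ Z, w c z) * w a d * w b d * w e d + (∑ z ∈ Z, w c z) * (∑ z ∈ Z, w e z) * w a d * w b d
            + 2 * (∑ z ∈ Z, w b z) * w a d * w c d * w e d + (∑ z ∈ Z, w b z) * (∑ z ∈ Z, w e z) * w a d * w c d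
            + (∑ z ∈ Z, w b z) * (∑ z ∈ Z, w c z) * w a d * w e d + 2 * (∑ z ∈ Z, w a z) * w b d * w c d * w e d
            + (∑ z ∈ Z, w a z) * (∑ z ∈ Z, w e z) * w b d * w c d
            + (∑ z ∈ Z, w a z) * (∑ z ∈ Z, w c z) * w b d * w e d
            + (∑ z ∈ Z, w a z) * (∑ z ∈ Z, w b z) * w c d * w e d + w e c * w a d * w b d * w c d
            + w e c * (∑ z ∈ Z, w c z) * w a d * w b d - w e c * (∑ z ∈ Z, w a z) * (∑ z ∈ Z, w b z) * w c d
            + w c b * w a d * w b d * w e d + w c b * (∑ z ∈ Z, w b z) * w a d * w e d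
            - w c b * (∑ z ∈ Z, w a z) * (∑ z ∈ Z, w e z) * w b d - w c b * w e c * w a d * w b d ^ 2
            - w c b * w e c * (∑ z ∈ Z, w b z) * w a d * w b d - w c b * w e c * (∑ z ∈ Z, w a z) * w b d
            - w c b * w e c * (∑ z ∈ Z, w a z) * w b d ^ 2
            - w c b * w e c * (∑ z ∈ Z, w a z) * (∑ z ∈ Z, w b z) * w b d + w b a * w a d * w c d * w e d
            - w b a * (∑ z ∈ Z, w c z) * (∑ z ∈ Z, w e z) * w a d + w b a * (∑ z ∈ Z, w a z) * w c d * w e d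
            - w b a * w e c * w a d * w c d - w b a * w e c * (∑ z ∈ Z, w c z) * w a d
            - w b a * w e c * (∑ z ∈ Z, w a z) * w c d - w b a * w c b * w a d ^ 2 * w e d
            - w b a * w c b * (∑ z ∈ Z, w e z) * w a d - w b a * w c b * (∑ z ∈ Z, w e z) * w a d ^ 2
            - w b a * w c b * (∑ z ∈ Z, w a z) * w a d * w e d
            - w b a * w c b * (∑ z ∈ Z, w a z) * (∑ z ∈ Z, w e z) * w a d - w b a * w c b * w e c * w a d
            - w b a * w c b * w e c * w a d * w b d - w b a * w c b * w e c * w a d ^ 2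
            - w b a * w c b * w e c * w a d ^ 2 * w b d - w b a * w c b * w e c * (∑ z ∈ Z, w b z) * w a d ^ 2
            - w b a * w c b * w e c * (∑ z ∈ Z, w a z) * w b d - w b a * w c b * w e c * (∑ z ∈ Z, w a z) * w a d
            - w b a * w c b * w e c * (∑ z ∈ Z, w a z) * w a d * w b d
            - w b a * w c b * w e c * (∑ z ∈ Z, w a z) * (∑ z ∈ Z, w b z) * w a d
            - w b a ^ 2 * w c b * w e c * w a d ^ 2 - w b a ^ 2 * w c b * w e c * (∑ z ∈ Z, w a z) * w a d) * (Y d * Φ)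
        + (-(2 * w b d * w c d * w e d) - (∑ z ∈ Z, w e z) * w b d * w c d - (∑ z ∈ Z, w c z) * w b d * w e d
            - (∑ z ∈ Z, w b z) * w c d * w e d + w e c * (∑ z ∈ Z, w b z) * w c d + w c b * (∑ z ∈ Z, w e z) * w b d
            + w c b * w e c * w b d + w c b * w e c * w b d ^ 2 + w c b * w e c * (∑ z ∈ Z, w b z) * w b d
            - w b a * w c d * w e d + w b a * w e c * w c d + w b a * w c b * w a d * w e d
            + w b a * w c b * (∑ z ∈ Z, w e z) * w a d + w b a * w c b * w e c * w b d
            + w b a * w c b * w e c * w a d + w b a * w c b * w e c * w a d * w b d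
            + w b a * w c b * w e c * (∑ z ∈ Z, w b z) * w a d + w b a ^ 2 * w c b * w e c * w a d) * (Y a * Y d * Φ)
        + (-(2 * w a d * w c d * w e d) - (∑ z ∈ Z, w e z) * w a d * w c d - (∑ z ∈ Z, w c z) * w a d * w e d
            - (∑ z ∈ Z, w a z) * w c d * w e d + w e c * (∑ z ∈ Z, w a z) * w c d - w c b * w a d * w e d
            + w c b * w e c * w a d * w b d + w c b * w e c * (∑ z ∈ Z, w a z) * w b d
            + w b a * w c b * w e c * w a d ^ 2 + w b a * w c b * w e c * (∑ z ∈ Z, w a z) * w a d) * (Y b * Y d * Φ)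
        + (-(2 * w a d * w b d * w e d) - (∑ z ∈ Z, w e z) * w a d * w b d - (∑ z ∈ Z, w b z) * w a d * w e d
            - (∑ z ∈ Z, w a z) * w b d * w e d - w e c * w a d * w b d + w b a * (∑ z ∈ Z, w e z) * w a d
            + w b a * w e c * w a d) * (Y c * Y d * Φ)
        + (-(2 * w a d * w b d * w c d) - (∑ z ∈ Z, w c z) * w a d * w b d - (∑ z ∈ Z, w b z) * w a d * w c d
            - (∑ z ∈ Z, w a z) * w b d * w c d + w c b * (∑ z ∈ Z, w a z) * w b d + w b a * (∑ z ∈ Z, w c z) * w a d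
            + w b a * w c b * w a d + w b a * w c b * w a d ^ 2 + w b a * w c b * (∑ z ∈ Z, w a z) * w a d) * (Y e * Y d * Φ)
        + (w c d * w e d - w e c * w c d - w c b * w e c * w b d - w b a * w c b * w e c * w a d) * (Y a * Y b * Y d * Φ)
        + (w b d * w e d) * (Y a * Y c * Y d * Φ)
        + (w b d * w c d - w c b * w b d - w b a * w c b * w a d) * (Y a * Y e * Y d * Φ)
        + (w a d * w e d) * (Y b * Y c * Y d * Φ)
        + (w a d * w c d) * (Y b * Y e * Y d * Φ)
        + (w a d * w b d - w b a * w a d) * (Y c * Y e * Y d * Φ))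
      + ∑ d ∈ D, ∑ d' ∈ D.erase d, ((-(w c d * w e d * w a d' * w b d') - w b d * w e d * w a d' * w c d'
            - w b d * w c d * w a d' * w e d' + w e c * w c d * w a d' * w b d' + w c b * w b d * w a d' * w e d'
            - w c b * w e c * w b d * w a d' * w b d' - w c b * w e c * (∑ z ∈ Z, w a z) * w b d * w b d'
            + w b a * w c d * w e d * w a d' - w b a * w e c * w c d * w a d'
            - w b a * w c b * w a d * w a d' * w e d' - w b a * w c b * (∑ z ∈ Z, w e z) * w a d * w a d'
            - w b a * w c b * w e c * w b d * w a d' - 2 * w b a * w c b * w e c * w b d * w a d' ^ 2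
            - w b a * w c b * w e c * w a d * w a d' - 3 * w b a * w c b * w e c * w a d * w a d' * w b d'
            - w b a * w c b * w e c * (∑ z ∈ Z, w b z) * w a d * w a d'
            - 2 * w b a * w c b * w e c * (∑ z ∈ Z, w a z) * w b d * w a d'
            - w b a ^ 2 * w c b * w e c * w a d * w a d') * (Y d * Y d' * Φ)
        + (w c b * w e c * w b d * w b d' + 2 * w b a * w c b * w e c * w b d * w a d') * (Y a * Y d * Y d' * Φ)
        + (w b a * w c b * w e c * w a d * w a d') * (Y b * Y d * Y d' * Φ)
        + (w b a * w c b * w a d * w a d') * (Y e * Y d * Y d' * Φ))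
      + ∑ d ∈ D, ∑ d' ∈ D.erase d, ∑ d'' ∈ (D.erase d).erase d', (-(2 * w b a * w c b * w e c * w b d * w a d' * w a d'')) * (Y d * Y d' * Y d'' * Φ) := by
  classical
  obtain ⟨M, hMdef⟩ : ∃ M : Finset α, M = ({a, b, c, e} : Finset α) := ⟨_, rfl⟩
  have hMiff : ∀ x, x ∈ M ↔ x = a ∨ x = b ∨ x = c ∨ x = e := by
    intro x; rw [hMdef]; simp only [Finset.mem_insert, Finset.mem_singleton]
  have haM : a ∈ M := (hMiff a).2 (Or.inl rfl)
  have hbM : b ∈ M := (hMiff b).2 (Or.inr (Or.inl rfl))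
  have hcM : c ∈ M := (hMiff c).2 (Or.inr (Or.inr (Or.inl rfl)))
  have heM : e ∈ M := (hMiff e).2 (Or.inr (Or.inr (Or.inr rfl)))
  have hMZ : Disjoint M Z := by
    rw [Finset.disjoint_left]; intro x hx
    rcases (hMiff x).1 hx with rfl | rfl | rfl | rfl
    · exact haZ
    · exact hbZ
    · exact hcZ
    · exact heZ
  have hDm : ∀ d ∈ D, d ∉ M ∧ d ∉ Z ∧ (w a d ≠ 0 ∨ w b d ≠ 0 ∨ w c d ≠ 0 ∨ w e d ≠ 0) := by
    intro d hd
    obtain ⟨⟨h1, h2⟩, h3⟩ := (hDiff d).1 hd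
    exact ⟨hMdef ▸ h1, h2, h3⟩
  have hDunit : ∀ d ∈ D, ∀ q, w d q = if q = d then 1 else 0 :=
    fun d hd => hD d (hDm d hd).2.1 (hMdef ▸ (hDm d hd).1) (hDm d hd).2.2
  set σ₁ : ℂ := w b a with hσ₁
  set σ₂ : ℂ := w c b with hσ₂
  set σ₃ : ℂ := w e c with hσ₃
  set a₀ : ℂ := ∑ z ∈ Z, w a z with ha₀
  set b₀ : ℂ := ∑ z ∈ Z, w b z with hb₀
  set c₀ : ℂ := ∑ z ∈ Z, w c z with hc₀
  set e₀ : ℂ := ∑ z ∈ Z, w e z with he₀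
  -- trivial when an inert token of `Z` is missing from the column
  rcases eq_or_ne Φ 0 with hΦ0 | hΦ0
  · simp only [hΦ0, mul_zero, add_zero, Finset.sum_const_zero]
  -- otherwise `Z ⊆ J`
  have hYZ : ∀ z ∈ Z, Y z = if z ∈ J then 1 else 0 := by
    intro z hz; rw [hY, Finset.sum_congr rfl (fun q _ => hZ z hz q), Finset.sum_ite_eq' J z]
  have hZJ : Z ⊆ J := by
    intro z hz; by_contra hzJ
    exact hΦ0 (by rw [hΦ]; exact Finset.prod_eq_zero hz (by rw [hYZ z hz, if_neg hzJ]))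
  -- the read exits inside the column
  obtain ⟨JD, hJDdef⟩ : ∃ JD : Finset α, JD = D.filter (· ∈ J) := ⟨_, rfl⟩
  have hJDiff : ∀ d, d ∈ JD ↔ d ∈ D ∧ d ∈ J := by intro d; rw [hJDdef, Finset.mem_filter]
  have hJDsub : JD ⊆ D := fun d hd => ((hJDiff d).1 hd).1
  have hYd : ∀ d ∈ D, Y d = if d ∈ J then 1 else 0 := by
    intro d hd; rw [hY, Finset.sum_congr rfl (fun q _ => hDunit d hd q), Finset.sum_ite_eq' J d]
  have hYd1 : ∀ d ∈ JD, Y d = 1 := fun d hd => by rw [hYd d (hJDsub hd), if_pos ((hJDiff d).1 hd).2]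
  have hYd0 : ∀ d ∈ D, d ∉ JD → Y d = 0 := fun d hd hn => by
    rw [hYd d hd, if_neg (fun h => hn ((hJDiff d).2 ⟨hd, h⟩))]
  -- the movers' values
  set na : ℕ := if a ∈ J then 1 else 0 with hna
  set nb : ℕ := if b ∈ J then 1 else 0 with hnb
  set nc : ℕ := if c ∈ J then 1 else 0 with hnc
  set ne : ℕ := if e ∈ J then 1 else 0 with hne
  have h01 : ∀ (P : Prop) [Decidable P], (if P then 1 else 0 : ℕ) = 0 ∨ (if P then 1 else 0 : ℕ) = 1 := by
    intro P _; by_cases hP : P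
    · exact Or.inr (if_pos hP)
    · exact Or.inl (if_neg hP)
  have hsplit : ∀ u, Y u = (∑ z ∈ Z, w u z) + ∑ q ∈ J \ Z, w u q := by
    intro u; rw [hY, ← Finset.sum_union (Finset.disjoint_sdiff), Finset.union_sdiff_of_subset hZJ]
  have hind : ∀ (x : α) (y : ℂ), x ∉ Z → (if x ∈ J \ Z then y else 0) = ((if x ∈ J then 1 else 0 : ℕ) : ℂ) * y := by
    intro x y hx
    by_cases hxJ : x ∈ J
    · rw [if_pos (Finset.mem_sdiff.2 ⟨hxJ, hx⟩), if_pos hxJ]; simp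
    · rw [if_neg (fun h' => hxJ (Finset.mem_sdiff.1 h').1), if_neg hxJ]; simp
  have hrest : ∀ u, (∀ q, q ∉ Z → q ∉ M → q ∉ D → w u q = 0) →
      ∑ q ∈ J \ Z, w u q = (na : ℂ) * w u a + (nb : ℂ) * w u b + (nc : ℂ) * w u c + (ne : ℂ) * w u e + ∑ d ∈ JD, w u d := by
    intro u hu
    have haD : a ∉ D := fun h' => (hDm a h').1 haM
    have hbD : b ∉ D := fun h' => (hDm b h').1 hbM
    have hcD : c ∉ D := fun h' => (hDm c h').1 hcM
    have heD : e ∉ D := fun h' => (hDm e h').1 heM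
    have hpt : ∀ q ∈ J \ Z, w u q = (if q = a then w u a else 0) + (if q = b then w u b else 0)
        + (if q = c then w u c else 0) + (if q = e then w u e else 0) + (if q ∈ D then w u q else 0) := by
      intro q hq
      have hqZ : q ∉ Z := (Finset.mem_sdiff.1 hq).2
      by_cases h1 : q = a
      · rw [h1]; simp [hab, hac, hae, haD]
      by_cases h2 : q = b
      · rw [h2]; simp [hab.symm, hbc, hbe, hbD]
      by_cases h3 : q = c
      · rw [h3]; simp [hac.symm, hbc.symm, hce, hcD]
      by_cases h4 : q = e
      · rw [h4]; simp [hae.symm, hbe.symm, hce.symm, heD]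
      by_cases h5 : q ∈ D
      · simp [h1, h2, h3, h4, h5]
      · have hqM : q ∉ M := fun h' => by
          rcases (hMiff q).1 h' with h' | h' | h' | h'
          · exact h1 h'
          · exact h2 h'
          · exact h3 h'
          · exact h4 h'
        simp [h1, h2, h3, h4, h5, hu q hqZ hqM h5]
    rw [Finset.sum_congr rfl hpt, Finset.sum_add_distrib, Finset.sum_add_distrib, Finset.sum_add_distrib,
      Finset.sum_add_distrib, Finset.sum_ite_eq' (J \ Z) a, Finset.sum_ite_eq' (J \ Z) b, Finset.sum_ite_eq' (J \ Z) c,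
      Finset.sum_ite_eq' (J \ Z) e, hind a _ haZ, hind b _ hbZ, hind c _ hcZ, hind e _ heZ, ← Finset.sum_filter]
    have hf : (J \ Z).filter (· ∈ D) = JD := by
      ext q
      rw [Finset.mem_filter, Finset.mem_sdiff, hJDiff]
      constructor
      · rintro ⟨⟨hqJ, -⟩, hqD⟩; exact ⟨hqD, hqJ⟩
      · rintro ⟨hqD, hqJ⟩; exact ⟨⟨hqJ, (hDm q hqD).2.1⟩, hqD⟩
    rw [hf]
  have hzero : ∀ u, u ∈ M → ∀ q, q ∉ Z → q ∉ M → q ∉ D → w u q = 0 := by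
    intro u hu q hqZ hqM hqD
    by_contra hne0
    apply hqD
    rw [hDiff]
    refine ⟨⟨hMdef ▸ hqM, hqZ⟩, ?_⟩
    rcases (hMiff u).1 hu with rfl | rfl | rfl | rfl
    · exact Or.inl hne0
    · exact Or.inr (Or.inl hne0)
    · exact Or.inr (Or.inr (Or.inl hne0))
    · exact Or.inr (Or.inr (Or.inr hne0))
  have hYa : Y a = (na : ℂ) + a₀ + ∑ d ∈ JD, w a d := by
    rw [hsplit a, hrest a (hzero a haM), haa, hab₀, hac₀, hae₀]; ring
  have hYb : Y b = (nb : ℂ) + σ₁ * na + b₀ + ∑ d ∈ JD, w b d := by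
    rw [hsplit b, hrest b (hzero b hbM), hbb, hbc₀, hbe₀]; ring
  have hYc : Y c = (nc : ℂ) + σ₂ * nb + c₀ + ∑ d ∈ JD, w c d := by
    rw [hsplit c, hrest c (hzero c hcM), hcc, hca₀, hce₀]; ring
  have hYe : Y e = (ne : ℂ) + σ₃ * nc + e₀ + ∑ d ∈ JD, w e d := by
    rw [hsplit e, hrest e (hzero e heM), hee, hea₀, heb₀]; ring
  -- the budget
  have hbudget : JD.card + na + nb + nc + ne ≤ 3 := by
    obtain ⟨M4, hM4⟩ : ∃ M4 : Finset α, M4 = M.filter (· ∈ J) := ⟨_, rfl⟩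
    have hM4iff : ∀ q, q ∈ M4 ↔ q ∈ M ∧ q ∈ J := by intro q; rw [hM4, Finset.mem_filter]
    have hsub : JD ∪ M4 ⊆ J \ Z := by
      intro q hq
      rw [Finset.mem_union, hJDiff, hM4iff] at hq
      rcases hq with ⟨hqD, hqJ⟩ | ⟨hqM, hqJ⟩
      · exact Finset.mem_sdiff.2 ⟨hqJ, (hDm q hqD).2.1⟩
      · exact Finset.mem_sdiff.2 ⟨hqJ, Finset.disjoint_left.1 hMZ hqM⟩
    have hdisj : Disjoint JD M4 := by
      rw [Finset.disjoint_left]; intro q hq hq'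
      rw [hJDiff] at hq; rw [hM4iff] at hq'
      exact (hDm q hq.1).1 hq'.1
    have hcard := Finset.card_le_card hsub
    rw [Finset.card_union_of_disjoint hdisj, Finset.card_sdiff_of_subset hZJ] at hcard
    have hM4c : M4.card = na + nb + nc + ne := by
      rw [hM4, hMdef, Finset.card_filter, Finset.sum_insert (by simp [hab, hac, hae]),
        Finset.sum_insert (by simp [hbc, hbe]), Finset.sum_pair hce]
      simp only [hna, hnb, hnc, hne, add_assoc]
    omega
  -- restrict the exit sums to the column and evaluate the exits' indicators
  have hR2 : ∀ F : α → α → ℂ, (∀ d ∈ D, ∀ d' ∈ D, d ∉ JD ∨ d' ∉ JD → F d d' = 0) →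
      ∑ d ∈ D, ∑ d' ∈ D.erase d, F d d' = ∑ d ∈ JD, ∑ d' ∈ JD.erase d, F d d' := by
    intro F hF
    have hin : ∀ d ∈ D, ∑ d' ∈ D.erase d, F d d' = ∑ d' ∈ JD.erase d, F d d' := by
      intro d hd
      refine (Finset.sum_subset (Finset.erase_subset_erase _ hJDsub) fun d' hd' hn => ?_).symm
      exact hF d hd d' (Finset.mem_erase.1 hd').2
        (Or.inr fun h => hn (Finset.mem_erase.2 ⟨(Finset.mem_erase.1 hd').1, h⟩))
    rw [Finset.sum_congr rfl hin]
    refine (Finset.sum_subset hJDsub fun d hd hn => Finset.sum_eq_zero fun d' hd' => ?_).symm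
    exact hF d hd d' (hJDsub (Finset.mem_erase.1 hd').2) (Or.inl hn)
  have hR3 : ∀ F : α → α → α → ℂ, (∀ d ∈ D, ∀ d' ∈ D, ∀ d'' ∈ D, d ∉ JD ∨ d' ∉ JD ∨ d'' ∉ JD → F d d' d'' = 0) →
      ∑ d ∈ D, ∑ d' ∈ D.erase d, ∑ d'' ∈ (D.erase d).erase d', F d d' d'' =
        ∑ d ∈ JD, ∑ d' ∈ JD.erase d, ∑ d'' ∈ (JD.erase d).erase d', F d d' d'' := by
    intro F hF
    have hin : ∀ d ∈ D, ∀ d' ∈ D.erase d, ∑ d'' ∈ (D.erase d).erase d', F d d' d'' =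
        ∑ d'' ∈ (JD.erase d).erase d', F d d' d'' := by
      intro d hd d' hd'
      refine (Finset.sum_subset (Finset.erase_subset_erase _ (Finset.erase_subset_erase _ hJDsub))
        fun d'' hd'' hn => ?_).symm
      have h1 := Finset.mem_erase.1 hd''
      have h2 := Finset.mem_erase.1 h1.2
      exact hF d hd d' (Finset.mem_erase.1 hd').2 d'' h2.2
        (Or.inr (Or.inr fun h => hn (Finset.mem_erase.2 ⟨h1.1, Finset.mem_erase.2 ⟨h2.1, h⟩⟩)))
    have hmid : ∀ d ∈ D, ∑ d' ∈ D.erase d, ∑ d'' ∈ (JD.erase d).erase d', F d d' d'' =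
        ∑ d' ∈ JD.erase d, ∑ d'' ∈ (JD.erase d).erase d', F d d' d'' := by
      intro d hd
      refine (Finset.sum_subset (Finset.erase_subset_erase _ hJDsub) fun d' hd' hn => ?_).symm
      refine Finset.sum_eq_zero fun d'' hd'' => ?_
      have h1 := Finset.mem_erase.1 hd''
      have h2 := Finset.mem_erase.1 h1.2
      exact hF d hd d' (Finset.mem_erase.1 hd').2 d'' (hJDsub h2.2)
        (Or.inr (Or.inl fun h => hn (Finset.mem_erase.2 ⟨(Finset.mem_erase.1 hd').1, h⟩)))
    rw [Finset.sum_congr rfl fun d hd => by rw [Finset.sum_congr rfl (hin d hd), hmid d hd]]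
    refine (Finset.sum_subset hJDsub fun d hd hn =>
      Finset.sum_eq_zero fun d' hd' => Finset.sum_eq_zero fun d'' hd'' => ?_).symm
    have h1 := Finset.mem_erase.1 hd''
    have h2 := Finset.mem_erase.1 h1.2
    exact hF d hd d' (hJDsub (Finset.mem_erase.1 hd').2) d'' (hJDsub h2.2) (Or.inl hn)
  rw [(Finset.sum_subset hJDsub fun d hd hn => by rw [hYd0 d hd hn]; ring).symm,
    hR2 _ fun d hd d' hd' hn => by
      rcases hn with hn | hn
      · rw [hYd0 d hd hn]; ring
      · rw [hYd0 d' hd' hn]; ring,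
    hR3 _ fun d hd d' hd' d'' hd'' hn => by
      rcases hn with hn | hn | hn
      · rw [hYd0 d hd hn]; ring
      · rw [hYd0 d' hd' hn]; ring
      · rw [hYd0 d'' hd'' hn]; ring]
  rw [Finset.sum_congr rfl fun d hd => by rw [hYd1 d hd],
    Finset.sum_congr rfl fun d hd => Finset.sum_congr rfl fun d' hd' => by
      rw [hYd1 d hd, hYd1 d' (Finset.mem_of_mem_erase hd')],
    Finset.sum_congr rfl fun d hd => Finset.sum_congr rfl fun d' hd' => Finset.sum_congr rfl fun d'' hd'' => by
      rw [hYd1 d hd, hYd1 d' (Finset.mem_of_mem_erase hd'), hYd1 d'' (Finset.mem_of_mem_erase (Finset.mem_of_mem_erase hd''))]]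
  -- ★ the identity
  have hid := chain₄_column_identity JD (fun d => w a d) (fun d => w b d) (fun d => w c d) (fun d => w e d)
    a₀ b₀ c₀ e₀ σ₁ σ₂ σ₃ na nb nc ne (h01 _) (h01 _) (h01 _) (h01 _) hbudget (Y a) (Y b) (Y c) (Y e) hYa hYb hYc hYe
  have hid' := congrArg (· * Φ) hid
  simp only [add_mul, Finset.sum_mul] at hid'
  rw [hid']
  refine congrArg₂ (· + ·) (congrArg₂ (· + ·) (congrArg₂ (· + ·) (by ring)
    (Finset.sum_congr rfl fun d _ => by ring))
    (Finset.sum_congr rfl fun d _ => Finset.sum_congr rfl fun d' _ => by ring))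
    (Finset.sum_congr rfl fun d _ => Finset.sum_congr rfl fun d' _ => Finset.sum_congr rfl fun d'' _ => by ring)

end SecondShell

end

end Summit.ValiantsHypothesis.ValiantsHypothesis.Theorems.BarrierLever.HiddenStates
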